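import Summits.QuantumFields.YangMills.Theorems.BalabanUVNodesN15KingModelComplexLinkOperatorNorm
import HarnessLib
/-!
# BalabanUVNodes ∕ N15 — THE KING-MODEL RUNG (PART Ϛ-m): THE NUMERICAL RANGE AND THE COERCIVITY OF THE COMPLEXIFIED GAUSSIAN ACTION on the window — `|⟨φ, M_{U,V}φ⟩ − D₀‖φ‖²| ≤ 2(d+1)(1+ε)c‖φ‖²`,
# hence `Re⟨φ, M_{U,V}φ⟩ ≥ (m² − 2(d+1)cε)‖φ‖²`: the complex Gaussian weight `e^{−⟨φ̄, M_{U,V}φ⟩}` is integrable uniformly on the window; the Hermitian part of `M_{U,V}` is PART Ͱ's `−cΔ_W+m²` at the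
# averaged field `W = (U+Vᴴ)∕2`, itself in the window
# (Track A, DAG node N15 = NE2; FAN-OUT v1.1 §N15 s3 «KING-MODEL RUNG … + what the curved case adds»; count-neutral)
HONEST FRAMING.  Count-neutral (cell `pub-ymgap`, seat `pub-ymgap-dag-n15-e` g43; `--supports stmt-QuantumFields-27247 --as helper` = K3ᴬ, KEY MAP v3).  One finite torus at fixed
spacing; King's `A = 0` model, FINE covariance layer only; nothing of Bałaban's (3.42) ∕ Thm 3.4 for `G(U)` asserted; nothing continuum ∕ ℝ⁴ ∕ OS ∕ Clay; NOT a node discharge.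
WHAT IS DECIDED.  [Balaban1985BackgroundPropagators] §3.B complexifies the Gaussian actions `⟨φ̄, Δ_{U′U}φ⟩` whose integrals define the densities of §3 (Thm 3.4 p.400, (3.50)–(3.53)); their
convergence needs a positive-definite REAL PART, uniformly in the field.  In King's model, on the window `‖U(b)‖, ‖V(b)‖ ≤ 1+ε` (`c ≥ 0`; for coercivity also `2(d+1)cε < m²`), with
`⟨v, w⟩ := star v ⬝ᵥ w` on `T × n → 𝕜` and `‖v‖` the Euclidean norm:
* §1 `star_dotProduct_eq_inner`, `norm_star_dotProduct_le`, `star_dotProduct_self`, ★ `norm_quadForm_cxHop_le` (`|⟨v, T_{U,V}v⟩| ≤ 2(d+1)(1+ε)c·‖v‖²`, Ϛ-l `l2_opNorm_cxHop_le`), `quadForm_cxLapF_eq`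
  (`⟨v, M_{U,V}v⟩ = D₀‖v‖² − ⟨v, T_{U,V}v⟩`);
* §2 ★★★ **`norm_quadForm_cxLapF_sub_le`** — THE NUMERICAL RANGE of `M_{U,V}` lies in the disc `|z − D₀| ≤ 2(d+1)(1+ε)c` (scaled by `‖v‖²`) — sharper than Ϛ-g's Gershgorin, which it implies;
  ★★★ **`re_quadForm_cxLapF_ge`** — COERCIVITY: `(m² − 2(d+1)cε)·‖v‖² ≤ Re⟨v, M_{U,V}v⟩` (the complexified Gaussian action has positive-definite real part on the whole window, uniformly in the
  volume, the fibre and the field; at `ε = 0`, `V = Uᴴ` unitary this is Ͱ-f `re_quadForm_covLapF_ge`'s `m²`); ★★ `re_quadForm_cxLapF_le` (`≤ (m²+2(d+1)c(2+ε))‖v‖²`), ★★ `abs_im_quadForm_cxLapF_le`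
  (`|Im⟨v,Mv⟩| ≤ 2(d+1)(1+ε)c‖v‖²`: a sector of half-angle `< π∕2` about the positive axis);
* §3 ★★ **`norm_toLp_cxLapF_mulVec_ge`** (`m′²‖v‖ ≤ ‖M_{U,V}v‖`: Lax–Milgram lower bound — a third proof of invertibility, and of Ϛ-l's `‖G‖ ≤ 1∕m′²` in the vector form
  ★★ `norm_toLp_cxLapF_inv_mulVec_le`);
* §4 ★★ **`hermitianPart_cxLapF`** — `½(M_{U,V} + M_{U,V}ᴴ) = −cΔ_W + m²` with `W(b) = ½(U(b) + V(b)ᴴ)` (PART Ͱ-a's `covLapF` at a generally NON-unitary field), `norm_avgField_le` (`W` is in the polydisc of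
  radius `1+ε`), ★ `re_quadForm_eq_quadForm_hermitianPart` (`Re⟨v, M_{U,V}v⟩ = ⟨v, (−cΔ_W+m²)v⟩` as a real number).
PRIOR TREE ART (by name): Ϛ-l (`l2_opNorm_cxHop_le`), Ϛ-g (`cxLapF_mulVec_eq_sub`, `norm_toLp_mulVec_le`), Ϛ-b (`shifted_D0`, `isUnit_cxLapF`), Ϛ-a (`cxLapF_conjTranspose`, `cxHop_add`, `cxHop_smul`,
`cxLapF_adjoint`), Ͱ-f (`re_star_dotProduct_le_norm_mul_norm`, `re_quadForm_covLapF_ge` — the unitary case), Mathlib (`EuclideanSpace.inner_toLp_toLp`, `norm_inner_le_norm`, `inner_self_eq_norm_sq_to_K`,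
`RCLike.re_le_norm`∕`abs_im_le_norm`).  Dedup (rg at filing): basename 0 files; needles `quadForm_cxLapF|quadForm_cxHop|hermitianPart_cxLapF|avgField` 0 tree files.  Locators:
[Balaban1985BackgroundPropagators] Thm 3.4 p.400, (3.50)–(3.53) p.400, (3.46) p.398 (L²-norm inequalities; the sup norms are defined in (3.39) p.397); [King1986] (4.4) p.670.  v1.1 (doc-only, ERRATUM-Ϛ1): locator «(3.39) p.397» ↦ «(3.46) p.398» on the two Lax–Milgram bounds; `norm_toLp_cxLapF_mulVec_ge` keeps its (unused) `hwin` binder for signature stability (ref-K READ-697 N1: the bound holds for every `m²`).  0 `sorry`.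
-/

noncomputable section
open scoped BigOperators ComplexConjugate ComplexOrder Matrix.Norms.L2Operator InnerProductSpace
open Finset Matrix WithLp

namespace Summit.QuantumFields.YangMills.BalabanUVNodes.N15KingModelRung.Covariant

open Literature.MathematicalPhysics.QuantumFieldTheory.LatticeDiamagneticInequality (Hopping blk)
open Literature.MathematicalPhysics.QuantumFieldTheory.Balaban1983to89.B5Prop11Plancherel (Tor unitVec)
open Literature.MathematicalPhysics.QuantumFieldTheory.King1986.Torus (lapF)

variable {d : ℕ} (K : Fin (d + 1) → ℕ) [hK : ∀ μ, NeZero (K μ)]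
variable {𝕜 : Type*} [RCLike 𝕜] {n : Type*} [Fintype n] [DecidableEq n] {c m2 ε : ℝ}

/-! ## §1 The quadratic form of the hopping matrix -/

omit [DecidableEq n] in
/-- `star v ⬝ᵥ w = ⟪v, w⟫` in `ℓ²(T × n)`. [folklore] -/
theorem star_dotProduct_eq_inner (v w : Tor K × n → 𝕜) :
    star v ⬝ᵥ w = ⟪(toLp 2 v : EuclideanSpace 𝕜 (Tor K × n)), toLp 2 w⟫_𝕜 := by
  rw [EuclideanSpace.inner_toLp_toLp, dotProduct_comm]

omit [DecidableEq n] in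
/-- CAUCHY–SCHWARZ: `|star v ⬝ᵥ w| ≤ ‖v‖·‖w‖`. [folklore] -/
theorem norm_star_dotProduct_le (v w : Tor K × n → 𝕜) :
    ‖star v ⬝ᵥ w‖ ≤ ‖(toLp 2 v : EuclideanSpace 𝕜 (Tor K × n))‖ * ‖(toLp 2 w : EuclideanSpace 𝕜 (Tor K × n))‖ := by
  rw [star_dotProduct_eq_inner]
  exact norm_inner_le_norm _ _

omit [DecidableEq n] in
/-- `star v ⬝ᵥ v = ‖v‖²`. [folklore] -/
theorem star_dotProduct_self (v : Tor K × n → 𝕜) : star v ⬝ᵥ v = ((‖(toLp 2 v : EuclideanSpace 𝕜 (Tor K × n))‖ : 𝕜)) ^ 2 := by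
  rw [star_dotProduct_eq_inner, inner_self_eq_norm_sq_to_K]

/-- ★ **THE QUADRATIC FORM OF THE TWO-SIDED HOPPING MATRIX**: `‖U(b)‖, ‖V(b)‖ ≤ 1+ε` ⟹ `|⟨v, T_{U,V}v⟩| ≤ 2(d+1)(1+ε)c·‖v‖²` (`c ≥ 0`; Ϛ-l `‖T_{U,V}‖ ≤ 2(d+1)(1+ε)c`).
[cite: Balaban1985BackgroundPropagators, (3.23) p.394, (3.50) p.400; King1986, (4.4) p.670] -/
theorem norm_quadForm_cxHop_le (hc : 0 ≤ c) {U V : Tor K × Fin (d + 1) → Matrix n n 𝕜} (hU : ∀ b, ‖U b‖ ≤ 1 + ε) (hV : ∀ b, ‖V b‖ ≤ 1 + ε)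
    (v : Tor K × n → 𝕜) :
    ‖star v ⬝ᵥ (cxHop K c U V *ᵥ v)‖ ≤ 2 * ((d : ℝ) + 1) * ((1 + ε) * c) * ‖(toLp 2 v : EuclideanSpace 𝕜 (Tor K × n))‖ ^ 2 := by
  refine (norm_star_dotProduct_le K v _).trans ?_
  have h := norm_toLp_mulVec_le (n := Tor K × n) (cxHop K c U V) v
  calc ‖(toLp 2 v : EuclideanSpace 𝕜 (Tor K × n))‖ * ‖(toLp 2 (cxHop K c U V *ᵥ v) : EuclideanSpace 𝕜 (Tor K × n))‖
      ≤ ‖(toLp 2 v : EuclideanSpace 𝕜 (Tor K × n))‖ * (2 * ((d : ℝ) + 1) * ((1 + ε) * c) * ‖(toLp 2 v : EuclideanSpace 𝕜 (Tor K × n))‖) :=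
        mul_le_mul_of_nonneg_left (h.trans (mul_le_mul_of_nonneg_right (l2_opNorm_cxHop_le K hc hU hV) (norm_nonneg _))) (norm_nonneg _)
    _ = 2 * ((d : ℝ) + 1) * ((1 + ε) * c) * ‖(toLp 2 v : EuclideanSpace 𝕜 (Tor K × n))‖ ^ 2 := by ring

/-- `⟨v, M_{U,V}v⟩ = D₀·‖v‖² − ⟨v, T_{U,V}v⟩`. [cite: Balaban1985BackgroundPropagators, (3.23) p.394] -/
theorem quadForm_cxLapF_eq (c m2 : ℝ) (U V : Tor K × Fin (d + 1) → Matrix n n 𝕜) (v : Tor K × n → 𝕜) :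
    star v ⬝ᵥ (cxLapF K c m2 U V *ᵥ v)
      = (((m2 + 2 * ((d : ℝ) + 1) * c : ℝ) : 𝕜)) * ((‖(toLp 2 v : EuclideanSpace 𝕜 (Tor K × n))‖ : 𝕜)) ^ 2 - star v ⬝ᵥ (cxHop K c U V *ᵥ v) := by
  rw [cxLapF_mulVec_eq_sub, dotProduct_sub, dotProduct_smul, star_dotProduct_self, smul_eq_mul]

/-! ## §2 The numerical range, coercivity, the sector -/

/-- ★★★ **THE NUMERICAL RANGE OF `M_{U,V}` LIES IN THE DISC `|z − D₀| ≤ 2(d+1)(1+ε)c`** (scaled by `‖v‖²`): for `c ≥ 0` and `‖U(b)‖, ‖V(b)‖ ≤ 1+ε`,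
`|⟨v, M_{U,V}v⟩ − D₀‖v‖²| ≤ 2(d+1)(1+ε)c·‖v‖²` for every `v`. [cite: Balaban1985BackgroundPropagators, Thm 3.4 p.400, (3.50) p.400; King1986, (4.4) p.670] -/
theorem norm_quadForm_cxLapF_sub_le (hc : 0 ≤ c) (m2 : ℝ) {U V : Tor K × Fin (d + 1) → Matrix n n 𝕜} (hU : ∀ b, ‖U b‖ ≤ 1 + ε) (hV : ∀ b, ‖V b‖ ≤ 1 + ε)
    (v : Tor K × n → 𝕜) :
    ‖star v ⬝ᵥ (cxLapF K c m2 U V *ᵥ v) - (((m2 + 2 * ((d : ℝ) + 1) * c : ℝ) : 𝕜)) * ((‖(toLp 2 v : EuclideanSpace 𝕜 (Tor K × n))‖ : 𝕜)) ^ 2‖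
      ≤ 2 * ((d : ℝ) + 1) * ((1 + ε) * c) * ‖(toLp 2 v : EuclideanSpace 𝕜 (Tor K × n))‖ ^ 2 := by
  rw [quadForm_cxLapF_eq, sub_sub_cancel_left, norm_neg]
  exact norm_quadForm_cxHop_le K hc hU hV v

/-- ★★★ **COERCIVITY OF THE COMPLEXIFIED GAUSSIAN ACTION**: for `c ≥ 0`, `0 ≤ ε`, `2(d+1)cε < m²` (so `m′² = m² − 2(d+1)cε > 0`) and `‖U(b)‖, ‖V(b)‖ ≤ 1+ε`:
`(m² − 2(d+1)cε)·‖v‖² ≤ Re⟨v, M_{U,V}v⟩` for every `v` — the real part of the complex action is positive definite UNIFORMLY in the volume, the fibre and the field (the complex Gaussian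
weight `exp(−⟨φ̄, M_{U,V}φ⟩)` is dominated by `exp(−m′²‖φ‖²)`). [cite: Balaban1985BackgroundPropagators, Thm 3.4 p.400, (3.50)–(3.53) p.400; King1986, (4.4) p.670] -/
theorem re_quadForm_cxLapF_ge (hc : 0 ≤ c) (m2 : ℝ) {U V : Tor K × Fin (d + 1) → Matrix n n 𝕜} (hU : ∀ b, ‖U b‖ ≤ 1 + ε) (hV : ∀ b, ‖V b‖ ≤ 1 + ε)
    (v : Tor K × n → 𝕜) :
    (m2 - 2 * ((d : ℝ) + 1) * c * ε) * ‖(toLp 2 v : EuclideanSpace 𝕜 (Tor K × n))‖ ^ 2 ≤ RCLike.re (star v ⬝ᵥ (cxLapF K c m2 U V *ᵥ v)) := by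
  set N : ℝ := ‖(toLp 2 v : EuclideanSpace 𝕜 (Tor K × n))‖ with hN
  have h := norm_quadForm_cxLapF_sub_le K hc m2 hU hV v
  have hre : RCLike.re (star v ⬝ᵥ (cxLapF K c m2 U V *ᵥ v) - (((m2 + 2 * ((d : ℝ) + 1) * c : ℝ) : 𝕜)) * ((N : 𝕜)) ^ 2)
      ≥ -(2 * ((d : ℝ) + 1) * ((1 + ε) * c) * N ^ 2) := by
    have h1 := RCLike.abs_re_le_norm (star v ⬝ᵥ (cxLapF K c m2 U V *ᵥ v) - (((m2 + 2 * ((d : ℝ) + 1) * c : ℝ) : 𝕜)) * ((N : 𝕜)) ^ 2)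
    have h2 := neg_abs_le (RCLike.re (star v ⬝ᵥ (cxLapF K c m2 U V *ᵥ v) - (((m2 + 2 * ((d : ℝ) + 1) * c : ℝ) : 𝕜)) * ((N : 𝕜)) ^ 2))
    linarith
  have hcast : RCLike.re ((((m2 + 2 * ((d : ℝ) + 1) * c : ℝ) : 𝕜)) * ((N : 𝕜)) ^ 2) = (m2 + 2 * ((d : ℝ) + 1) * c) * N ^ 2 := by
    rw [← RCLike.ofReal_pow, ← RCLike.ofReal_mul, RCLike.ofReal_re]
  rw [map_sub, hcast] at hre
  have hD := shifted_D0 (d := d) c m2 ε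
  nlinarith [hre, sq_nonneg N]

/-- ★★ UPPER BOUND OF THE REAL PART: `Re⟨v, M_{U,V}v⟩ ≤ (m² + 2(d+1)c(2+ε))·‖v‖²`. [cite: Balaban1985BackgroundPropagators, Thm 3.4 p.400; King1986, (4.4) p.670] -/
theorem re_quadForm_cxLapF_le (hc : 0 ≤ c) (m2 : ℝ) {U V : Tor K × Fin (d + 1) → Matrix n n 𝕜} (hU : ∀ b, ‖U b‖ ≤ 1 + ε) (hV : ∀ b, ‖V b‖ ≤ 1 + ε)
    (v : Tor K × n → 𝕜) :
    RCLike.re (star v ⬝ᵥ (cxLapF K c m2 U V *ᵥ v)) ≤ (m2 + 2 * ((d : ℝ) + 1) * c * (2 + ε)) * ‖(toLp 2 v : EuclideanSpace 𝕜 (Tor K × n))‖ ^ 2 := by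
  set N : ℝ := ‖(toLp 2 v : EuclideanSpace 𝕜 (Tor K × n))‖ with hN
  have h := norm_quadForm_cxLapF_sub_le K hc m2 hU hV v
  have hre : RCLike.re (star v ⬝ᵥ (cxLapF K c m2 U V *ᵥ v) - (((m2 + 2 * ((d : ℝ) + 1) * c : ℝ) : 𝕜)) * ((N : 𝕜)) ^ 2)
      ≤ 2 * ((d : ℝ) + 1) * ((1 + ε) * c) * N ^ 2 := (RCLike.re_le_norm _).trans h
  have hcast : RCLike.re ((((m2 + 2 * ((d : ℝ) + 1) * c : ℝ) : 𝕜)) * ((N : 𝕜)) ^ 2) = (m2 + 2 * ((d : ℝ) + 1) * c) * N ^ 2 := by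
    rw [← RCLike.ofReal_pow, ← RCLike.ofReal_mul, RCLike.ofReal_re]
  rw [map_sub, hcast] at hre
  nlinarith [hre, sq_nonneg N]

/-- ★★ THE IMAGINARY PART: `|Im⟨v, M_{U,V}v⟩| ≤ 2(d+1)(1+ε)c·‖v‖²` — with §2's coercivity the numerical range lies in a sector of half-opening `< π∕2` about the positive real axis.
[cite: Balaban1985BackgroundPropagators, Thm 3.4 p.400; King1986, (4.4) p.670] -/
theorem abs_im_quadForm_cxLapF_le (hc : 0 ≤ c) (m2 : ℝ) {U V : Tor K × Fin (d + 1) → Matrix n n 𝕜} (hU : ∀ b, ‖U b‖ ≤ 1 + ε) (hV : ∀ b, ‖V b‖ ≤ 1 + ε)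
    (v : Tor K × n → 𝕜) :
    |RCLike.im (star v ⬝ᵥ (cxLapF K c m2 U V *ᵥ v))| ≤ 2 * ((d : ℝ) + 1) * ((1 + ε) * c) * ‖(toLp 2 v : EuclideanSpace 𝕜 (Tor K × n))‖ ^ 2 := by
  set N : ℝ := ‖(toLp 2 v : EuclideanSpace 𝕜 (Tor K × n))‖ with hN
  have h := norm_quadForm_cxLapF_sub_le K hc m2 hU hV v
  have him : |RCLike.im (star v ⬝ᵥ (cxLapF K c m2 U V *ᵥ v) - (((m2 + 2 * ((d : ℝ) + 1) * c : ℝ) : 𝕜)) * ((N : 𝕜)) ^ 2)|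
      ≤ 2 * ((d : ℝ) + 1) * ((1 + ε) * c) * N ^ 2 := (RCLike.abs_im_le_norm _).trans h
  have hcast : RCLike.im ((((m2 + 2 * ((d : ℝ) + 1) * c : ℝ) : 𝕜)) * ((N : 𝕜)) ^ 2) = 0 := by
    rw [← RCLike.ofReal_pow, ← RCLike.ofReal_mul, RCLike.ofReal_im]
  rwa [map_sub, hcast, sub_zero] at him

/-! ## §3 Lax–Milgram: lower bound on `‖Mv‖`, vector form of `‖G‖ ≤ 1∕m′²` -/

/-- ★★ **THE LAX–MILGRAM LOWER BOUND**: on the window (`2(d+1)cε < m²`), `(m² − 2(d+1)cε)·‖v‖ ≤ ‖M_{U,V}v‖` (coercivity + Cauchy–Schwarz) — a third route to invertibility.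
[cite: Balaban1985BackgroundPropagators, Thm 3.4 p.400, (3.46) p.398] -/
theorem norm_toLp_cxLapF_mulVec_ge (hc : 0 ≤ c) (hwin : 2 * ((d : ℝ) + 1) * c * ε < m2)
    {U V : Tor K × Fin (d + 1) → Matrix n n 𝕜} (hU : ∀ b, ‖U b‖ ≤ 1 + ε) (hV : ∀ b, ‖V b‖ ≤ 1 + ε) (v : Tor K × n → 𝕜) :
    (m2 - 2 * ((d : ℝ) + 1) * c * ε) * ‖(toLp 2 v : EuclideanSpace 𝕜 (Tor K × n))‖
      ≤ ‖(toLp 2 (cxLapF K c m2 U V *ᵥ v) : EuclideanSpace 𝕜 (Tor K × n))‖ := by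
  set N : ℝ := ‖(toLp 2 v : EuclideanSpace 𝕜 (Tor K × n))‖ with hN
  have hm' := shifted_mass_pos hwin
  by_cases hv : N = 0
  · rw [hv, mul_zero]; exact norm_nonneg _
  have hNpos : 0 < N := lt_of_le_of_ne (norm_nonneg _) (Ne.symm hv)
  have h1 := re_quadForm_cxLapF_ge K hc m2 hU hV v
  have h2 : RCLike.re (star v ⬝ᵥ (cxLapF K c m2 U V *ᵥ v)) ≤ N * ‖(toLp 2 (cxLapF K c m2 U V *ᵥ v) : EuclideanSpace 𝕜 (Tor K × n))‖ :=
    (RCLike.re_le_norm _).trans (norm_star_dotProduct_le K v _)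
  have h3 : (m2 - 2 * ((d : ℝ) + 1) * c * ε) * N * N ≤ ‖(toLp 2 (cxLapF K c m2 U V *ᵥ v) : EuclideanSpace 𝕜 (Tor K × n))‖ * N := by
    nlinarith [h1, h2]
  exact le_of_mul_le_mul_right h3 hNpos

/-- ★★ **VECTOR FORM OF `‖G_{U,V}‖ ≤ 1∕m′²`**: `‖G_{U,V}w‖ ≤ ‖w‖∕(m² − 2(d+1)cε)` on the window (Lax–Milgram; Ϛ-l's operator-norm statement by the Schur test is the same number).
[cite: Balaban1985BackgroundPropagators, Thm 3.4 p.400, (3.46) p.398] -/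
theorem norm_toLp_cxLapF_inv_mulVec_le (hc : 0 ≤ c) (hm : 0 < m2) (hε : 0 ≤ ε) (hwin : 2 * ((d : ℝ) + 1) * c * ε < m2)
    {U V : Tor K × Fin (d + 1) → Matrix n n 𝕜} (hU : ∀ b, ‖U b‖ ≤ 1 + ε) (hV : ∀ b, ‖V b‖ ≤ 1 + ε) (w : Tor K × n → 𝕜) :
    ‖(toLp 2 ((cxLapF K c m2 U V)⁻¹ *ᵥ w) : EuclideanSpace 𝕜 (Tor K × n))‖ ≤ (m2 - 2 * ((d : ℝ) + 1) * c * ε)⁻¹ * ‖(toLp 2 w : EuclideanSpace 𝕜 (Tor K × n))‖ := by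
  have hm' := shifted_mass_pos hwin
  set v := (cxLapF K c m2 U V)⁻¹ *ᵥ w with hv
  have hMv : cxLapF K c m2 U V *ᵥ v = w := by rw [hv, mulVec_mulVec, cxLapF_mul_inv K hc hm hε hwin hU hV, one_mulVec]
  have h := norm_toLp_cxLapF_mulVec_ge K hc hwin hU hV v
  rw [hMv] at h
  rw [inv_mul_eq_div, le_div_iff₀ hm', mul_comm]
  exact h

/-! ## §4 The Hermitian part is PART Ͱ's operator at the averaged field -/

omit hK in
/-- THE AVERAGED FIELD `W(b) = ½(U(b) + V(b)ᴴ)` lies in the polydisc of radius `1+ε` whenever `U` and `V` do. [folklore] -/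
theorem norm_avgField_le {U V : Tor K × Fin (d + 1) → Matrix n n 𝕜} (hU : ∀ b, ‖U b‖ ≤ 1 + ε) (hV : ∀ b, ‖V b‖ ≤ 1 + ε) (b : Tor K × Fin (d + 1)) :
    ‖((2 : 𝕜)⁻¹) • (U b + (V b)ᴴ)‖ ≤ 1 + ε := by
  rw [norm_smul, norm_inv, RCLike.norm_ofNat]
  have h2 : ‖(V b)ᴴ‖ ≤ 1 + ε := by rw [Matrix.l2_opNorm_conjTranspose]; exact hV b
  have h := (norm_add_le (U b) ((V b)ᴴ)).trans (add_le_add (hU b) h2)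
  linarith

omit [Fintype n] in
/-- ★★ **THE HERMITIAN PART OF THE COMPLEXIFIED OPERATOR**: `½(M_{U,V} + M_{U,V}ᴴ) = −cΔ_W + m² = covLapF K c m² W` with `W(b) = ½(U(b)+V(b)ᴴ)` — PART Ͱ-a's operator at a (generally
non-unitary) averaged field in the same window. [cite: Balaban1985BackgroundPropagators, (3.23) p.394, (3.50) p.400] -/
theorem hermitianPart_cxLapF (c m2 : ℝ) (U V : Tor K × Fin (d + 1) → Matrix n n 𝕜) :
    ((2 : 𝕜)⁻¹) • (cxLapF K c m2 U V + (cxLapF K c m2 U V)ᴴ) = covLapF K c m2 (fun b => ((2 : 𝕜)⁻¹) • (U b + (V b)ᴴ)) := by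
  have hadj : (fun b => (((2 : 𝕜)⁻¹) • (U b + (V b)ᴴ))ᴴ) = fun b => ((2 : 𝕜)⁻¹) • (V b + (U b)ᴴ) := by
    funext b
    rw [conjTranspose_smul, conjTranspose_add, conjTranspose_conjTranspose, add_comm]
    congr 1
    rw [RCLike.star_def, map_inv₀, RCLike.conj_ofNat]
  rw [← cxLapF_adjoint, hadj, cxLapF_conjTranspose]
  unfold cxLapF
  have h2 : ((2 : 𝕜)⁻¹) • (U + fun b => (V b)ᴴ) = fun b => ((2 : 𝕜)⁻¹) • (U b + (V b)ᴴ) := by funext b; rfl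
  have h3 : ((2 : 𝕜)⁻¹) • (V + fun b => (U b)ᴴ) = fun b => ((2 : 𝕜)⁻¹) • (V b + (U b)ᴴ) := by funext b; rfl
  rw [← h2, ← h3, cxHop_smul, cxHop_add, smul_add, smul_sub]
  have htwo : (2 : 𝕜)⁻¹ + (2 : 𝕜)⁻¹ = 1 := by norm_num
  ext p q
  simp only [Matrix.add_apply, Matrix.sub_apply, Matrix.smul_apply, diagonal_apply, smul_eq_mul]
  split_ifs
  · have := htwo; linear_combination (((m2 + 2 * ((d : ℝ) + 1) * c : ℝ) : 𝕜)) * this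
  · ring

omit [DecidableEq n] in
/-- `⟨v, Aᴴv⟩ = conj⟨v, Av⟩`. [folklore] -/
theorem star_dotProduct_conjTranspose_mulVec (A : Matrix (Tor K × n) (Tor K × n) 𝕜) (v : Tor K × n → 𝕜) :
    star v ⬝ᵥ (Aᴴ *ᵥ v) = starRingEnd 𝕜 (star v ⬝ᵥ (A *ᵥ v)) := by
  rw [Matrix.dotProduct_mulVec, Matrix.vecMul_conjTranspose, star_star, Matrix.star_dotProduct, starRingEnd_apply]

/-- ★ **THE REAL PART OF THE ACTION IS THE HERMITIAN PART's FORM**: `Re⟨v, M_{U,V}v⟩ = Re⟨v, (−cΔ_W+m²)v⟩` with `W = ½(U+Vᴴ)` (the right side is the form of a Hermitian matrix, Ͱ-a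
`isHermitian_covLapF`). [cite: Balaban1985BackgroundPropagators, (3.50) p.400] -/
theorem re_quadForm_eq_re_quadForm_hermitianPart (c m2 : ℝ) (U V : Tor K × Fin (d + 1) → Matrix n n 𝕜) (v : Tor K × n → 𝕜) :
    RCLike.re (star v ⬝ᵥ (covLapF K c m2 (fun b => ((2 : 𝕜)⁻¹) • (U b + (V b)ᴴ)) *ᵥ v)) = RCLike.re (star v ⬝ᵥ (cxLapF K c m2 U V *ᵥ v)) := by
  rw [← hermitianPart_cxLapF, Matrix.smul_mulVec, Matrix.add_mulVec, dotProduct_smul, dotProduct_add, smul_eq_mul, star_dotProduct_conjTranspose_mulVec,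
    RCLike.add_conj, ← mul_assoc, inv_mul_cancel₀ (two_ne_zero : (2 : 𝕜) ≠ 0), one_mul, RCLike.ofReal_re]

/-- ★★ COERCIVITY READ ON THE HERMITIAN PART: on the window, PART Ͱ-a's `−cΔ_W+m²` at the (non-unitary) averaged field `W = ½(U+Vᴴ)` satisfies `⟨v,(−cΔ_W+m²)v⟩ ≥ (m²−2(d+1)cε)‖v‖²` —
positive definite although `W` is not unitary. [cite: Balaban1985BackgroundPropagators, Thm 3.4 p.400; King1986, (4.4) p.670] -/
theorem re_quadForm_covLapF_avgField_ge (hc : 0 ≤ c) (m2 : ℝ) {U V : Tor K × Fin (d + 1) → Matrix n n 𝕜} (hU : ∀ b, ‖U b‖ ≤ 1 + ε) (hV : ∀ b, ‖V b‖ ≤ 1 + ε)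
    (v : Tor K × n → 𝕜) :
    (m2 - 2 * ((d : ℝ) + 1) * c * ε) * ‖(toLp 2 v : EuclideanSpace 𝕜 (Tor K × n))‖ ^ 2
      ≤ RCLike.re (star v ⬝ᵥ (covLapF K c m2 (fun b => ((2 : 𝕜)⁻¹) • (U b + (V b)ᴴ)) *ᵥ v)) := by
  rw [re_quadForm_eq_re_quadForm_hermitianPart]
  exact re_quadForm_cxLapF_ge K hc m2 hU hV v

end Summit.QuantumFields.YangMills.BalabanUVNodes.N15KingModelRung.Covariant

end
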